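import Literature.AlgebraicGeometry.Deformation.SmoothSchemeLiftObstructionCriterionGlueLineBundleCocycle
import Literature.AlgebraicGeometry.Deformation.SmoothSchemeLiftObstructionCriterionGlueClosedFibre
import Literature.AlgebraicGeometry.Deformation.SmoothSchemeLiftObstructionCriterionGlueBaseChange
import Literature.AlgebraicGeometry.Deformation.SmoothSchemeLiftObstructionCriterionGlueReduction
import Literature.AlgebraicGeometry.Motives.ThickeningModelNaturality
import HarnessLib

/-!
# Gluing the lifted charts, VI-e: the CLOSED-FIBRE READING of the overlap sections
# (Hartshorne, *Deformation Theory*, Thm. 6.4 (a) proof: «`𝓛' ⊗ 𝒪_X ≅ 𝓛`»; *Algebraic Geometry* II Ex. 5.18 (b))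

Layer `Literature/AlgebraicGeometry/Deformation` (cell `hodgecm-mathlib`, F-11 sub-line `F11SmoothRoadA`, α1 grandchild
`F11LiftWithLineBundle`, stub G2 — the BETWEEN seam S-cf of the MONO-G2 composition; THEOREMS ONLY — no definition, no instance,
no notation, no named fact).  Currency of ★ `…CriterionGlueLineBundleCocycle` (the D1 `variable` block VERBATIM: closed fibre
`X/Spec k` with its `k`-structures `halg`, coefficients `R ⊇ 𝔫`, principal affine cover `U`, cocycle-exact lifted gluing data `ψ`,
glued deformation `X'_R = Glue_R(ψ)` with charts `ι j`, overlap sections characterised by their chart-`j` readings `Λ_{jl}(G_{jl})`).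

NEW: an augmentation `ε : R →ₐ[k] k` and a morphism `c : X ⟶ X'_R` with the CHART SQUARES
`chartProj k U j ≫ c = Spec (ε ⊗ 1) ≫ ι j` (e.g. the inclusion of the closed fibre).

* §1 the chart projection over the coefficient FIELD `chartProj k U j : Spec (k ⊗_k Γ(U j)) ⟶ X` is an open immersion with
  range `U j` (`isOpenImmersion_chartProj_field`, `range_chartProj_field`; ★ `…GlueClosedFibre.chartIso_comp_ι`), so reading a
  section of `X` over `U j ∩ U l` in the field chart is injective (`appLE_chartOverlap_field_injective`).
* §2 **`appLE_closedFibre_overlapSection`** — THE HEAD: if `s_{jl} ∈ Γ(X'_R, ι j (C j) ∩ ι l (C l))` has chart-`j` reading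
  `Λ_{jl}(G_{jl})`, then `c^♯ s_{jl} = lid ((ε ⊗ 1) G_{jl})` in `Γ(X, U j ∩ U l)` — the lifted transition functions REDUCE along `c`
  to the closed-fibre transition functions.  Proof = ★ J1 §2 (`…GlueLineBundleBaseChange.appLE_baseChangeMap_overlapSection`) run
  along `c`: both sides read in the field chart `j`; the left is `a^♯ Λ^R_{jl}(G_{jl}) = Λ^k_{jl}((ε ⊗ 1) G_{jl})` by the naturality of
  the chart ring maps (★ `comp_chartRingHom_baseChange`), the right is `Λ^k_{jl}(1 ⊗ lid (…))` (★ `overlapRingHom_one_tmul`).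

Consumer (MONO-G2 integrator, BETWEEN): with `R := A⧸J`, `ε := π₀`, `c := p ≫ eA₀.hom` the closed fibre of `Glue_{A⧸J}(ψ')`,
`G := G⁰` of ★ `…GlueLineBundleConverse.exists_twistedCocycle_of_frames`: the transition functions of the closed-fibre frames of
`c^*M` (★ `IFrames.tf_pullback`) are the units `g := lid ((π₀ ⊗ 1) G⁰)` of ★ `PairLiftTwistedCocycleClosedFibre`, i.e. the `g` of
★ `PairLiftObstructionMove.exact_correctedUnits_of_move` — which lets socket (I1) (stated on the closed fibre with frames) feed the
move lemma.  HC_CM is proved only modulo the 7 printed citations until rung 0 closes — nothing here bears on a summit statement.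

## References
* [Hartshorne2010] R. Hartshorne, *Deformation Theory*, GTM 257 (2010): Thm. 6.4 (a) and proof (pp. 50–51), Thm. 10.2 (a) proof (p. 81).
* [Hartshorne1977] R. Hartshorne, *Algebraic Geometry*, GTM 52 (1977): II Ex. 5.18 (b) (transition data of a locally free sheaf).
* [StacksProject] The Stacks Project, Tag 01JA (glueing schemes; functoriality).
-/

noncomputable section

-- `TopCat.Presheaf`/`TopCat.Sheaf` are not reducible (as in Mathlib's `AlgebraicGeometry/Modules`).
set_option backward.isDefEq.respectTransparency false

open CategoryTheory AlgebraicGeometry Opposite TopologicalSpace Limits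
open scoped TensorProduct

namespace Literature.AlgebraicGeometry.Deformation

section ClosedFibreReading

open Literature.AlgebraicGeometry.Motives Literature.AlgebraicGeometry.Morphisms Literature.AlgebraicGeometry.Modules

universe u

variable {k : Type u} [Field k] {X : Over (Spec (CommRingCat.of k))}
  [instΓ : ∀ W : X.left.Opens, Algebra k Γ(X.left, W)]
  (halg : ∀ (W : X.left.Opens) (s : k), algebraMap k Γ(X.left, W) s = (constToPresheaf X).app (op W) s)
  {R : Type u} [CommRing R] [Algebra k R] (ε : R →ₐ[k] k)
  {ι : Type u} (U : ι → X.left.affineOpens) (b : (j l : ι) → Γ(X.left, (U j).1))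
  (hb : ∀ j l, (U j).1 ⊓ (U l).1 = X.left.basicOpen (b j l))
  (ψ : (j l : ι) → R ⊗[k] Γ(X.left, (U j).1 ⊓ (U l).1) ≃ₐ[R] R ⊗[k] Γ(X.left, (U j).1 ⊓ (U l).1))
  (𝔫 : Ideal R) (h𝔫 : IsNilpotent 𝔫)
  (hψ : ∀ j l x, ψ j l x - x ∈ 𝔫 • (⊤ : Submodule R (R ⊗[k] Γ(X.left, (U j).1 ⊓ (U l).1))))
  (hcoc : ∀ (j l m : ι)
    (Φjl : R ⊗[k] Γ(X.left, (U j).1 ⊓ (U l).1) →ₐ[R] R ⊗[k] Γ(X.left, (U j).1 ⊓ (U l).1 ⊓ (U m).1))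
    (_ : ∀ a s, Φjl (a ⊗ₜ s) = a ⊗ₜ X.left.presheaf.map (homOfLE inf_le_left).op s)
    (Φlm : R ⊗[k] Γ(X.left, (U l).1 ⊓ (U m).1) →ₐ[R] R ⊗[k] Γ(X.left, (U j).1 ⊓ (U l).1 ⊓ (U m).1))
    (_ : ∀ a s, Φlm (a ⊗ₜ s) = a ⊗ₜ X.left.presheaf.map
      (homOfLE (le_inf (inf_le_left.trans inf_le_right) inf_le_right)).op s)
    (Φjm : R ⊗[k] Γ(X.left, (U j).1 ⊓ (U m).1) →ₐ[R] R ⊗[k] Γ(X.left, (U j).1 ⊓ (U l).1 ⊓ (U m).1))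
    (_ : ∀ a s, Φjm (a ⊗ₜ s) = a ⊗ₜ X.left.presheaf.map
      (homOfLE (le_inf (inf_le_left.trans inf_le_left) inf_le_right)).op s)
    (ρjl ρlm ρjm : R ⊗[k] Γ(X.left, (U j).1 ⊓ (U l).1 ⊓ (U m).1) ≃ₐ[R]
      R ⊗[k] Γ(X.left, (U j).1 ⊓ (U l).1 ⊓ (U m).1)),
    (∀ x, ρjl (Φjl x) = Φjl (ψ j l x)) → (∀ x, ρlm (Φlm x) = Φlm (ψ l m x)) →
    (∀ x, ρjm (Φjm x) = Φjm (ψ j m x)) → ρlm * ρjl = ρjm)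

omit instΓ in
/-- The chart projection `Spec (k ⊗_k Γ(U j)) ⟶ X` over the coefficient FIELD is an open immersion (an isomorphism onto `U j`).
[cite: Hartshorne2010, Thm. 10.2 (proof), p. 81] -/
theorem isOpenImmersion_chartProj_field [∀ W : X.left.Opens, Algebra k Γ(X.left, W)] (j : ι) :
    IsOpenImmersion (chartProj k U j) := by
  haveI := isIso_SpecMap_includeRight (k := k) Γ(X.left, (U j).1)
  rw [← chartIso_comp_ι U j]
  infer_instance

omit instΓ in
/-- The chart projection over the coefficient field has range `U j`. [cite: Hartshorne2010, Thm. 10.2 (proof), p. 81] -/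
theorem range_chartProj_field [∀ W : X.left.Opens, Algebra k Γ(X.left, W)] (j : ι) :
    Set.range (chartProj k U j) = ((U j).1 : Set X.left) := by
  haveI := isIso_SpecMap_includeRight (k := k) Γ(X.left, (U j).1)
  have hsurj : Function.Surjective (Spec.map (CommRingCat.ofHom (Algebra.TensorProduct.includeRight (R := k) (A := k)
      (B := Γ(X.left, (U j).1))).toRingHom)) :=
    (Spec.map (CommRingCat.ofHom (Algebra.TensorProduct.includeRight (R := k) (A := k)
      (B := Γ(X.left, (U j).1))).toRingHom)).homeomorph.surjective
  rw [chartProj_eq, Scheme.Hom.comp_base, TopCat.coe_comp, Set.range_comp, hsurj.range_eq, Set.image_univ]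
  exact (U j).2.range_fromSpec

omit instΓ in
/-- Reading a section of `X` over `U j ∩ U l` in the field chart `j` (over `chartOverlap k U j l`) is injective (indeed
bijective: the chart is an isomorphism onto `U j`). [cite: StacksProject, Tag 01JA] -/
theorem appLE_chartOverlap_field_injective [∀ W : X.left.Opens, Algebra k Γ(X.left, W)] (j l : ι) :
    Function.Injective (((chartOverlap k U j l).ι ≫ chartProj k U j).appLE ((U j).1 ⊓ (U l).1) ⊤
      (chartOverlap_le k U j l)) := by
  haveI := isOpenImmersion_chartProj_field (k := k) U j
  have hrange : (chartProj k U j).opensRange = (U j).1 :=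
    TopologicalSpace.Opens.ext (range_chartProj_field (k := k) U j)
  haveI : IsIso (((chartOverlap k U j l).ι ≫ chartProj k U j).appLE ((U j).1 ⊓ (U l).1) ⊤
      (chartOverlap_le k U j l)) := by
    refine isIso_appLE_top_of_opensRange_eq _ _ ?_ _
    rw [Scheme.Hom.opensRange_comp, Scheme.Opens.opensRange_ι, chartOverlap_eq,
      Scheme.Hom.image_preimage_eq_opensRange_inf, hrange]
    exact inf_eq_right.mpr inf_le_left
  exact (ConcreteCategory.bijective_of_isIso _).1

set_option maxHeartbeats 400000 in -- one glued scheme, one chart-ring naturality square (as ★ J1 §2)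
include hb h𝔫 hψ in
/-- **THE CLOSED-FIBRE READING OF THE OVERLAP SECTIONS.**  Let `c : X ⟶ X'_R = Glue_R(ψ)` satisfy the chart squares
`chartProj k U j ≫ c = Spec (ε ⊗ 1) ≫ ι j` for an augmentation `ε : R →ₐ[k] k` (e.g. the closed fibre of the glued
deformation).  If `s_{jl} ∈ Γ(X'_R, ι j (C j) ∩ ι l (C l))` has chart-`j` reading `Λ_{jl} (G_{jl})` (the characterisation of
★ `exists_overlapSections`), then `c^♯ s_{jl} = lid ((ε ⊗ 1) G_{jl})` in `Γ(X, U j ∩ U l)`: the lifted transition functions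
REDUCE to the closed-fibre transition functions ([Hartshorne2010] Thm. 6.4 (a): «`𝓛' ⊗ 𝒪_X ≅ 𝓛`»).  Proof: read both sides
in the field chart `j` (injective); the left side is `a^♯ Λ^R_{jl}(G_{jl}) = Λ^k_{jl}((ε ⊗ 1) G_{jl})` by the naturality of the
chart ring maps (★ `comp_chartRingHom_baseChange`), the right side is `Λ^k_{jl}(1 ⊗ lid(…))`.
[cite: Hartshorne2010, Thm. 6.4 (a) (proof, pp. 50–51); Thm. 10.2 (proof), p. 81] [cite: Hartshorne1977, II Ex. 5.18 (b)] -/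
theorem appLE_closedFibre_overlapSection
    (c : X.left ⟶ (deformationGlueDatum halg R U b hb ψ 𝔫 h𝔫 hψ hcoc).glueData.glued)
    (hc : ∀ j, chartProj k U j ≫ c =
      Spec.map (CommRingCat.ofHom (Algebra.TensorProduct.map ε (AlgHom.id k Γ(X.left, (U j).1))).toRingHom) ≫
        (deformationGlueDatum halg R U b hb ψ 𝔫 h𝔫 hψ hcoc).glueData.ι j)
    (G : (j l : ι) → R ⊗[k] Γ(X.left, (U j).1 ⊓ (U l).1))
    (s : (j l : ι) →
      Γ((deformationGlueDatum halg R U b hb ψ 𝔫 h𝔫 hψ hcoc).glueData.glued,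
        ((deformationGlueDatum halg R U b hb ψ 𝔫 h𝔫 hψ hcoc).glueData.ι j).opensRange ⊓
          ((deformationGlueDatum halg R U b hb ψ 𝔫 h𝔫 hψ hcoc).glueData.ι l).opensRange))
    (hs : ∀ j l, ((chartOverlap R U j l).ι ≫ (deformationGlueDatum halg R U b hb ψ 𝔫 h𝔫 hψ hcoc).glueData.ι j).appLE
        (((deformationGlueDatum halg R U b hb ψ 𝔫 h𝔫 hψ hcoc).glueData.ι j).opensRange ⊓
          ((deformationGlueDatum halg R U b hb ψ 𝔫 h𝔫 hψ hcoc).glueData.ι l).opensRange) ⊤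
        (top_le_preimage_opensRange_inf halg R U b hb ψ 𝔫 h𝔫 hψ hcoc j l) (s j l) =
      overlapRingHom halg R U j l (G j l))
    (j l : ι) (hle : (U j).1 ⊓ (U l).1 ≤
      c ⁻¹ᵁ (((deformationGlueDatum halg R U b hb ψ 𝔫 h𝔫 hψ hcoc).glueData.ι j).opensRange ⊓
        ((deformationGlueDatum halg R U b hb ψ 𝔫 h𝔫 hψ hcoc).glueData.ι l).opensRange)) :
    c.appLE (((deformationGlueDatum halg R U b hb ψ 𝔫 h𝔫 hψ hcoc).glueData.ι j).opensRange ⊓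
        ((deformationGlueDatum halg R U b hb ψ 𝔫 h𝔫 hψ hcoc).glueData.ι l).opensRange) ((U j).1 ⊓ (U l).1) hle (s j l) =
      Algebra.TensorProduct.lid k Γ(X.left, (U j).1 ⊓ (U l).1)
        (Algebra.TensorProduct.map ε (AlgHom.id k Γ(X.left, (U j).1 ⊓ (U l).1)) (G j l)) := by
  apply appLE_chartOverlap_field_injective U j l
  -- read the left side through the chart square
  rw [← CommRingCat.comp_apply, Scheme.Hom.appLE_comp_appLE]
  obtain ⟨a, ha⟩ : ∃ a : (chartOverlap k U j l : (Spec (CommRingCat.of (k ⊗[k] Γ(X.left, (U j).1)))).Opens).toScheme ⟶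
      (chartOverlap R U j l : (Spec (CommRingCat.of (R ⊗[k] Γ(X.left, (U j).1)))).Opens).toScheme,
      a ≫ (chartOverlap R U j l).ι = (chartOverlap k U j l).ι ≫
        Spec.map (CommRingCat.ofHom (Algebra.TensorProduct.map ε (AlgHom.id k Γ(X.left, (U j).1))).toRingHom) :=
    ⟨(Scheme.isoOfEq _ (chartOverlap_baseChange ε U j l)).hom ≫
      (Spec.map (CommRingCat.ofHom (Algebra.TensorProduct.map ε (AlgHom.id k Γ(X.left, (U j).1))).toRingHom) ∣_
        chartOverlap R U j l), by rw [Category.assoc, morphismRestrict_ι, Scheme.isoOfEq_hom_ι_assoc]⟩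
  have hnat := comp_chartRingHom_baseChange ε (U j).2 (chartProj R U j) rfl (chartProj k U j) rfl
    (map_toRingHom_tmul ε (U j).1) a ha (overlapRingHom_tmul_one halg R U j l) (overlapRingHom_one_tmul halg R U j l)
    (overlapRingHom_tmul_one halg k U j l) (overlapRingHom_one_tmul halg k U j l)
    (map_toRingHom_tmul ε ((U j).1 ⊓ (U l).1))
  have e : ((chartOverlap k U j l).ι ≫ chartProj k U j) ≫ c =
      a ≫ ((chartOverlap R U j l).ι ≫ (deformationGlueDatum halg R U b hb ψ 𝔫 h𝔫 hψ hcoc).glueData.ι j) := by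
    rw [Category.assoc, hc, ← Category.assoc, ← ha, Category.assoc]
  rw [appLE_eq_of_eq e]
  have e2 : (a ≫ ((chartOverlap R U j l).ι ≫ (deformationGlueDatum halg R U b hb ψ 𝔫 h𝔫 hψ hcoc).glueData.ι j)).appLE
      (((deformationGlueDatum halg R U b hb ψ 𝔫 h𝔫 hψ hcoc).glueData.ι j).opensRange ⊓
        ((deformationGlueDatum halg R U b hb ψ 𝔫 h𝔫 hψ hcoc).glueData.ι l).opensRange) ⊤
      (by rw [Scheme.Hom.comp_preimage, top_le_iff.mp (top_le_preimage_opensRange_inf halg R U b hb ψ 𝔫 h𝔫 hψ hcoc j l)]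
          exact le_top) =
      ((chartOverlap R U j l).ι ≫ (deformationGlueDatum halg R U b hb ψ 𝔫 h𝔫 hψ hcoc).glueData.ι j).appLE
        (((deformationGlueDatum halg R U b hb ψ 𝔫 h𝔫 hψ hcoc).glueData.ι j).opensRange ⊓
          ((deformationGlueDatum halg R U b hb ψ 𝔫 h𝔫 hψ hcoc).glueData.ι l).opensRange) ⊤
        (top_le_preimage_opensRange_inf halg R U b hb ψ 𝔫 h𝔫 hψ hcoc j l) ≫ a.appTop := by
    rw [Scheme.Hom.appTop, Scheme.Hom.app_eq_appLE, Scheme.Hom.appLE_comp_appLE]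
    rfl
  erw [e2]
  rw [CommRingCat.comp_apply, hs j l]
  have h3 : a.appTop (overlapRingHom halg R U j l (G j l)) = overlapRingHom halg k U j l
      ((Algebra.TensorProduct.map ε (AlgHom.id k Γ(X.left, (U j).1 ⊓ (U l).1))).toRingHom (G j l)) :=
    RingHom.congr_fun hnat (G j l)
  rw [h3, AlgHom.toRingHom_eq_coe, RingHom.coe_coe]
  -- the right side: `(ε ⊗ 1) G = 1 ⊗ lid ((ε ⊗ 1) G)` in `k ⊗_k Γ`
  conv_lhs => rw [← (Algebra.TensorProduct.lid k Γ(X.left, (U j).1 ⊓ (U l).1)).symm_apply_apply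
    (Algebra.TensorProduct.map ε (AlgHom.id k Γ(X.left, (U j).1 ⊓ (U l).1)) (G j l))]
  rw [Algebra.TensorProduct.lid_symm_apply, overlapRingHom_one_tmul]

end ClosedFibreReading

end Literature.AlgebraicGeometry.Deformation

end
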